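import Literature.AnabelianGeometry.SemiGraphs.TemperedTorsionPoints
import Literature.AnabelianGeometry.SemiGraphs.TemperedCurveHyperbolicWitness
import Literature.IUT.HodgeTheaters.ZHatIntegersInjective
import HarnessLib

/-!
# [SemiAnbd] Thm 6.8 (iii) over the ORIGIN certificate (FACT-LIST row F-1730): the universal closure
# of `TemperedTorsionOrigin.TorsionPointsHolds` is FALSE over abstract data

Mochizuki, *Semi-graphs of anabelioids*, Publ. RIMS **42** (2006) [SemiAnbd], Thm. 6.8 (iii) p. 75
("suppose further that `X_K`, `Y_L` are once-punctured elliptic curves.  Then `α` preserves the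
decomposition groups of the torsion closed points …"). [cite: MochizukiSemiAnbd2006, Thm 6.8(iii) p.75]

PROOF-ONLY companion (abc-iut cell, block F fact-proving wave, seat abc-iut-f-056 floating onto the
unseated F-TRANCHES tranche 178; no definition, no new named fact) of `TemperedTorsionPoints.lean`
(abc-iut-L3 lineage; imported, never edited), which asserts Thm 6.8 (iii) only for data CERTIFIED by an
origin `Ω : TemperedTorsionOrigin p` (`TorsionPointsHolds Ω`).  SCHEMA VERDICT: the universal closure
over all `Ω` — in particular the all-certifying one — is FALSE:

* JUNK DATUM (`TemperedCurve.exists_twoPointToy`, not the datum of any curve): w5-d040's toy group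
  `Π^temp = G_{ℚ_p} × Ẑ × P` (`TemperedCurveHyperbolicWitness.lean`) with TWO closed points — the toy's
  CUSP (`D = G_{ℚ_p} × Ẑ × 1`, `I ≅ Ẑ`) and a NON-CUSPIDAL point with `D' = G_{ℚ_p} × 1 × 1` (closed,
  surjecting onto `G_{ℚ_p}`, meeting `Δ^temp` trivially);
* flag the non-cusp (resp. the cusp) as "the torsion closed point" on the source (resp. target) copy of
  this datum, both flagged "once-punctured elliptic": the identity `Π^temp ≅ Π^temp` does not carry the
  conjugacy class of `D'` to that of the NORMAL subgroup `D ≠ D'` (`not_preservesDecompOf_twoPointToy`),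
  so `IsoPreservesTorsionDecomp` fails and `not_forall_torsionPointsHolds` follows;
* bonus witness for F-1708 (Thm 6.5 (iv) `NoncuspidalNotLeCuspidal`): at this datum a non-cuspidal
  decomposition group IS contained in a cuspidal one (`not_noncuspidalNotLeCuspidal_twoPointToy`).

HONEST FRAMING: a refuted universal closure over ABSTRACT data says only that the origin certificate is
necessary; F-1730 stays consumable AT CERTIFIED data by name; nothing of [SemiAnbd] is refuted or
asserted; typed ≠ proved; no side taken on [IUTchIII] Cor. 3.12.
-/

noncomputable section

namespace Literature.AnabelianGeometry.SemiGraphs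

open scoped Pointwise

namespace TemperedCurve

variable {p : ℕ} [Fact p.Prime]

/-! ### The non-cuspidal section `D' = G_{ℚ_p} × 1 × 1` of the toy group -/

/-- Membership in `D' = G_{ℚ_p} × 1`. [cite: MochizukiSemiAnbd2006, §6 p.71] -/
theorem mem_toySect_iff (x : ToyPi p) :
    x ∈ ((⊤ : Subgroup (GQp p)).prod (⊥ : Subgroup (ZHat × Iw p))) ↔ x.2 = 1 := by
  simp [Subgroup.mem_prod]

/-- `D' = G_{ℚ_p} × 1` is closed. [cite: MochizukiSemiAnbd2006, §6 p.71] -/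
theorem isClosed_toySect :
    IsClosed (((⊤ : Subgroup (GQp p)).prod (⊥ : Subgroup (ZHat × Iw p)) : Subgroup (ToyPi p)) :
      Set (ToyPi p)) := by
  have : (((⊤ : Subgroup (GQp p)).prod (⊥ : Subgroup (ZHat × Iw p)) : Subgroup (ToyPi p)) :
      Set (ToyPi p)) = (fun x : ToyPi p => x.2) ⁻¹' {1} := by
    ext x; simpa using mem_toySect_iff (p := p) x
  rw [this]
  exact isClosed_singleton.preimage (by fun_prop)

/-- `D'` surjects onto `G_{ℚ_p}`. [cite: MochizukiSemiAnbd2006, §6 p.71] -/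
theorem fst_image_toySect :
    (ContinuousMonoidHom.fst (GQp p) (ZHat × Iw p)) ''
      (((⊤ : Subgroup (GQp p)).prod (⊥ : Subgroup (ZHat × Iw p)) : Subgroup (ToyPi p)) :
        Set (ToyPi p)) = Set.univ := by
  refine Set.eq_univ_of_forall fun g => ⟨(g, 1), ?_, rfl⟩
  exact (mem_toySect_iff (p := p) _).2 rfl

/-- `D' ∩ Δ^temp = 1` (`Δ^temp = Ker(pr₁)`). [cite: MochizukiSemiAnbd2006, §6 p.71] -/
theorem toySect_inf_ker_eq_bot :
    ((⊤ : Subgroup (GQp p)).prod (⊥ : Subgroup (ZHat × Iw p)) : Subgroup (ToyPi p)) ⊓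
      (ContinuousMonoidHom.fst (GQp p) (ZHat × Iw p)).toMonoidHom.ker = ⊥ := by
  rw [eq_bot_iff]
  rintro ⟨g, z⟩ ⟨hD, hK⟩
  have hz : z = 1 := (mem_toySect_iff (p := p) _).1 hD
  have hg : g = 1 := (MonoidHom.mem_ker).1 hK
  rw [Subgroup.mem_bot, hz, hg]
  rfl

/-- `D' ≤ D` and `D' ≠ D` (`Ẑ` is not trivial). [cite: MochizukiSemiAnbd2006, §6 p.71] -/
theorem toySect_lt_toyDecomp :
    ((⊤ : Subgroup (GQp p)).prod (⊥ : Subgroup (ZHat × Iw p)) : Subgroup (ToyPi p)) < toyDecomp p := by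
  refine lt_of_le_of_ne (fun x hx => (mem_toyDecomp_iff p x).2 ?_) fun h => ?_
  · rw [(mem_toySect_iff (p := p) x).1 hx]; rfl
  · -- if `D' = D` then every `z : Ẑ` satisfies `(1, (z, 1)) ∈ D'`, i.e. `z = 1`; but `ℤ ↪ Ẑ` (ℤ is
    -- residually finite, `Literature.IUT.HodgeTheaters.residuallyFinite_multiplicative_int`), so `Ẑ` is
    -- nontrivial.
    have hall : ∀ z : ZHat, z = 1 := fun z => by
      have hz : ((1, (z, 1)) : ToyPi p) ∈ toyDecomp p := (mem_toyDecomp_iff p _).2 rfl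
      rw [← h] at hz
      exact congrArg Prod.fst ((mem_toySect_iff (p := p) _).1 hz)
    haveI := Literature.IUT.HodgeTheaters.residuallyFinite_multiplicative_int
    have hinj : Function.Injective
        (fun n : Multiplicative ℤ => ProfiniteGrp.ProfiniteCompletion.etaFn (GrpCat.of (Multiplicative ℤ)) n) :=
      (ProfiniteGrp.ProfiniteCompletion.etaFn_injective_iff_residuallyFinite
        (GrpCat.of (Multiplicative ℤ))).mpr inferInstance
    have h01 := hinj ((hall _).trans (hall _).symm : (fun n : Multiplicative ℤ =>
        ProfiniteGrp.ProfiniteCompletion.etaFn (GrpCat.of (Multiplicative ℤ)) n) (Multiplicative.ofAdd 0) =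
      (fun n : Multiplicative ℤ =>
        ProfiniteGrp.ProfiniteCompletion.etaFn (GrpCat.of (Multiplicative ℤ)) n) (Multiplicative.ofAdd 1))
    exact absurd (Multiplicative.ofAdd.injective h01) (by decide)

/-! ### The two-point toy -/

/-- **JUNK DATUM** (not the datum of any curve): the toy group `Π^temp = G_{ℚ_p} × Ẑ × P` of
`TemperedCurve.toyHyperbolic` with TWO closed points — `true`, a cusp with `D = G_{ℚ_p} × Ẑ × 1`, and
`false`, a non-cuspidal point with `D' = G_{ℚ_p} × 1 × 1`.  All interface clauses hold.
[cite: MochizukiSemiAnbd2006, §6 pp.69-71] -/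
theorem exists_twoPointToy :
    ∃ X : TemperedCurve p, ∃ c n : X.Pt, X.IsCusp c ∧ ¬ X.IsCusp n ∧ X.decomp n < X.decomp c ∧
      (X.decomp c).Normal := by
  haveI : IsGalois ℚ_[p] (AlgebraicClosure ℚ_[p]) := {}
  haveI : T2Space (GQp p) := krullTopology_t2
  refine ⟨{ toyHyperbolic p with
    Pt := Bool
    IsCusp := fun b => b = true
    decomp := fun b => bif b then toyDecomp p else (⊤ : Subgroup (GQp p)).prod (⊥ : Subgroup (ZHat × Iw p))
    isClosed_decomp := fun b => ?_
    isOpen_aug_decomp := fun b => ?_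
    inertia_eq_bot := fun b hb => ?_
    inertia_equiv_zHat := fun b hb => ?_ }, true, false, rfl, Bool.false_ne_true, ?_, ?_⟩
  · cases b
    · exact isClosed_toySect
    · exact isClosed_toyDecomp p
  · cases b
    · change IsOpen ((ContinuousMonoidHom.fst (GQp p) (ZHat × Iw p)) ''
        (((⊤ : Subgroup (GQp p)).prod (⊥ : Subgroup (ZHat × Iw p)) : Subgroup (ToyPi p)) : Set (ToyPi p)))
      rw [fst_image_toySect]
      exact isOpen_univ
    · change IsOpen ((ContinuousMonoidHom.fst (GQp p) (ZHat × Iw p)) '' (toyDecomp p : Set (ToyPi p)))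
      rw [fst_image_toyDecomp]
      exact isOpen_univ
  · cases b
    · exact toySect_inf_ker_eq_bot
    · exact absurd rfl hb
  · cases b
    · exact absurd hb Bool.false_ne_true
    · exact ⟨inertiaEquiv p⟩
  · exact toySect_lt_toyDecomp
  · change (toyDecomp p).Normal
    unfold toyDecomp
    infer_instance

/-- At a datum with a NORMAL cuspidal decomposition group `D` strictly containing a non-cuspidal one
`D'`, the identity does not "preserve the decomposition groups" from `{non-cusp}` to `{cusp}`: the
class of `D'` is not the class `{D}`. [cite: MochizukiSemiAnbd2006, Thm 6.8 p.74] -/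
theorem not_preservesDecompOf_refl (X : TemperedCurve p) {c n : X.Pt} (hlt : X.decomp n < X.decomp c)
    (hN : (X.decomp c).Normal) :
    ¬ PreservesDecompOf X X (ContinuousMulEquiv.refl _) {n} {c} := by
  intro h
  obtain ⟨y, hy, γ, hγ⟩ := (h (X.decomp n)).1 ⟨n, rfl, 1, (one_smul _ _).symm⟩
  rw [Set.mem_singleton_iff] at hy
  subst hy
  rw [hN.conjAct γ] at hγ
  have hmap : (X.decomp n).map (ContinuousMulEquiv.refl X.PiTemp).toMulEquiv.toMonoidHom = X.decomp n :=
    Subgroup.map_id _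
  rw [hmap] at hγ
  exact (ne_of_lt hlt) hγ

/-- Thm 6.5 (iv) `NoncuspidalNotLeCuspidal` FAILS at such a datum (a third witness against F-1708).
[cite: MochizukiSemiAnbd2006, Thm 6.5(iv) p.72] -/
theorem not_noncuspidalNotLeCuspidal_of_lt (X : TemperedCurve p) {c n : X.Pt} (hc : X.IsCusp c)
    (hn : ¬ X.IsCusp n) (hlt : X.decomp n < X.decomp c) : ¬ X.NoncuspidalNotLeCuspidal := fun h =>
  h n c hn hc 1 1 (by rw [one_smul, one_smul]; exact hlt.le)

/-- Hence SOME datum of the interface violates Thm 6.5 (iv) as typed.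
[cite: MochizukiSemiAnbd2006, Thm 6.5(iv) p.72] -/
theorem exists_not_noncuspidalNotLeCuspidal : ∃ X : TemperedCurve p, ¬ X.NoncuspidalNotLeCuspidal := by
  obtain ⟨X, c, n, hc, hn, hlt, -⟩ := exists_twoPointToy (p := p)
  exact ⟨X, X.not_noncuspidalNotLeCuspidal_of_lt hc hn hlt⟩

/-- **FACT-LIST F-1730, universal closure REFUTED.**  At the all-certifying origin, Thm 6.8 (iii) as
typed (`IsoPreservesTorsionDecomp` for every `α`, in particular `α = id`) fails for the two-point toy
with the non-cusp flagged as the torsion closed point on the source and the cusp on the target.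
The row is consumable only at CERTIFIED data. [cite: MochizukiSemiAnbd2006, Thm 6.8(iii) p.75] -/
theorem not_forall_torsionPointsHolds (p : ℕ) [Fact p.Prime] :
    ¬ ∀ Ω : TemperedTorsionOrigin p, Ω.TorsionPointsHolds := by
  intro h
  obtain ⟨X, c, n, hc, hn, hlt, hN⟩ := exists_twoPointToy (p := p)
  let Ω : TemperedTorsionOrigin p :=
    { IsHyperbolicCurveOrigin := fun _ => True
      IsDomHomOrigin := fun _ => True
      IsDLocOrigin := fun _ => True
      IsFlagsOrigin := fun _ => True
      IsTorsionPtOrigin := fun _ => True }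
  let aX : CurveArithmeticFlags X :=
    { IsOncePuncturedElliptic := True, IsTorsionPt := fun x => x = n, IsIsogenousToGenusZero := True,
      IsAlgebraicPt := fun _ => True, IsDefinedOverNumberField := True }
  let aY : CurveArithmeticFlags X :=
    { IsOncePuncturedElliptic := True, IsTorsionPt := fun x => x = c, IsIsogenousToGenusZero := True,
      IsAlgebraicPt := fun _ => True, IsDefinedOverNumberField := True }
  let TX : TorsionPointData X aX :=
    { torsionPt := fun _ => n, range_torsionPt := by rw [Set.range_const]; ext x; simp [aX] }
  let TY : TorsionPointData X aY :=
    { torsionPt := fun _ => c, range_torsionPt := by rw [Set.range_const]; ext x; simp [aY] }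
  have h1 := (h Ω X X aX aY TX TY trivial trivial trivial trivial trivial trivial
    (ContinuousMulEquiv.refl _)).1 trivial trivial
  have hS : {x | aX.IsTorsionPt x} = {n} := by ext x; simp [aX]
  have hT : {y | aY.IsTorsionPt y} = {c} := by ext x; simp [aY]
  rw [hS, hT] at h1
  exact X.not_preservesDecompOf_refl hlt hN h1

end TemperedCurve

end Literature.AnabelianGeometry.SemiGraphs

end
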